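import Summits.Ventures.PercRepro.RankLevelSetExplicitLin2LargeSharp
import Summits.Ventures.PercRepro.RankLevelSetExplicitLin2
import Summits.Ventures.PercRepro.RankLevelSetExplicitLin2TailChernoff
import Summits.Ventures.PercRepro.RankLevelSetCoreFiveTwentyNine

/-!
# PercRepro — THE LARGE-CORANK THEOREM FROM THE CORE'S OWN FLAT BOUND `5·2^{q−3} − 1` (THE 5/8 RANGE) (p9, S4)

`proofs/SUBCLAIM-S4-p9.md` §S4.2⁗⁗. The rows of S4 cover the core coranks `q + 1 ≤ d ≤ q + 2^q` because the large-corank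
theorem `c025_core_explicit_large_of` (RankLevelSetExplicitLin2LargeSharp) is night-1's `core_all_corank_of_thresholds_of_bound q B`
at the BINARY flat bound `B = 2^q − 1` (corank `> q + B + 1`). The `e`-free core satisfies the sharper bound
`ncard_le_five_two_pow_of_eRk_le_of_free` (RankLevelSetExplicitLin2): every set of rank `≤ q` has `≤ 5·2^{q−3} − 1` points
(`q ≥ 6`). Night-1's theorem carries the hypothesis `2^q + 2 ≤ p`, used only through `choose_le_midCount_of_two_pow_le`
(every `(p−1)`-set has rank `> q` because a rank-`≤ q` set has `≤ 2^q − 1 < p − 1` points); with the bound `B` as a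
parameter the same argument needs only `B + 2 ≤ p` (p7's `choose_le_midCount_of_bound`):

* the core theorem in that form IS IN THE TREE — p7's `core_all_corank_of_bound_key` (RankLevelSetCoreFiveTwentyNine): night-1's
  theorem with `B + 2 ≤ p`, the regime-one threshold on `n` and the regime-two key as a hypothesis (supplied here by night-1's
  `choose_mul_le_choose_mul_of_threshold` from the regime-two inequality at `p`); nothing of night-1's is restated;
* `regime_one_of_base'` / `regime_two_of_base_exp` — the two regimes from kernel bases, for ANY constant `c` / exponent `e`;
* `flat_family_five_two_pow_of_free` — the flat family `|X| + q ≤ (5·2^{q−3} − 1) + j` for `ρ(X) ≤ j ≤ q` (`q ≥ 7`);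
* **`c025_core_explicit_large_of58`** — the `e`-free core of corank `> q + 5·2^{q−3}` from the bases `N₁`, `P₂` and
  `5·2^{q−3} + 1 ≤ p`;
* **`c025_level_succ_of_key_row_tail58`** — `c025_level_succ_of_key_row_tail` (RankLevelSetExplicitLin2LevelTail) with the
  rows over the coranks `q + 2 ≤ d ≤ q + 1 + 5·2^{q−2}` only (`5/8` of `2^{q+1}`), the Chernoff tail evaluated at that top
  corank (`8p₀ ≥ 9(q + 1 + 5·2^{q−2}) + 17(q+1) + 216`) and the large-corank theorem from its bases beyond it.
Axioms: standard.
-/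

open scoped Matroid

namespace PercRepro

namespace ThmN

open Set

variable {α : Type}

namespace Explicit

/-- **REGIME ONE FROM A BASE, ANY CONSTANT**: `c·n^q ≤ 2^n` for every `n ≥ m` once it holds at `n = m` and `2q ≤ m`
(the decay lemma `add_pow_le_pow_mul_two_pow`: `(m + t)^q ≤ m^q·2^t`). -/
theorem regime_one_of_base' (q c m : ℕ) (hm : 2 * q ≤ m) (hbase : c * m ^ q ≤ 2 ^ m) :
    ∀ n, m ≤ n → c * n ^ q ≤ 2 ^ n := by
  intro n hn
  obtain ⟨t, rfl⟩ := Nat.exists_eq_add_of_le hn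
  calc c * (m + t) ^ q ≤ c * (m ^ q * 2 ^ t) := Nat.mul_le_mul_left _ (add_pow_le_pow_mul_two_pow m q hm t)
    _ = (c * m ^ q) * 2 ^ t := by ring
    _ ≤ 2 ^ m * 2 ^ t := Nat.mul_le_mul_right _ hbase
    _ = 2 ^ (m + t) := by rw [pow_add]

/-- **REGIME TWO IS MONOTONE IN THE RANK, ANY EXPONENT** (`p ≥ q + 2`): from `2^{p+q}·2^e·(2a+1) ≤ 4^a` (`a = p − 1 − q`) to
the same at `p + 1` — the left side grows by `2·(2a+3)/(2a+1) ≤ 4`, the right side by `4`. -/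
theorem regime_two_succ_exp (q e p : ℕ) (hp : q + 2 ≤ p)
    (h : 2 ^ (p + q) * 2 ^ e * (2 * (p - 1 - q) + 1) ≤ 4 ^ (p - 1 - q)) :
    2 ^ (p + 1 + q) * 2 ^ e * (2 * (p + 1 - 1 - q) + 1) ≤ 4 ^ (p + 1 - 1 - q) := by
  set a := p - 1 - q with ha
  have ha1 : 1 ≤ a := by omega
  rw [show p + 1 - 1 - q = a + 1 by omega, show p + 1 + q = (p + q) + 1 by ring, pow_succ, pow_succ]
  set X := 2 ^ (p + q) * 2 ^ e with hX
  calc 2 ^ (p + q) * 2 * 2 ^ e * (2 * (a + 1) + 1) = X * (2 * (2 * (a + 1) + 1)) := by ring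
    _ ≤ X * (4 * (2 * a + 1)) := Nat.mul_le_mul_left _ (by omega)
    _ = (X * (2 * a + 1)) * 4 := by ring
    _ ≤ 4 ^ a * 4 := Nat.mul_le_mul_right _ h

/-- **REGIME TWO FROM A BASE, ANY EXPONENT**: `2^{p+q}·2^e·(2(p−1−q)+1) ≤ 4^{p−1−q}` for every `p ≥ p₀` once it holds at
`p₀ ≥ q + 2`. -/
theorem regime_two_of_base_exp (q e p₀ : ℕ) (hp₀ : q + 2 ≤ p₀)
    (hbase : 2 ^ (p₀ + q) * 2 ^ e * (2 * (p₀ - 1 - q) + 1) ≤ 4 ^ (p₀ - 1 - q)) :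
    ∀ p, p₀ ≤ p → 2 ^ (p + q) * 2 ^ e * (2 * (p - 1 - q) + 1) ≤ 4 ^ (p - 1 - q) := by
  intro p hp
  induction p, hp using Nat.le_induction with
  | base => exact hbase
  | succ p hp ih => exact regime_two_succ_exp q e p (by omega) ih

/-- `q + 32 ≤ 5·2^{q−3}` for `q ≥ 7` (`39 ≤ 80`; the right side doubles). -/
theorem add_thirtytwo_le_five_two_pow (q : ℕ) (hq : 7 ≤ q) : q + 32 ≤ 5 * 2 ^ (q - 3) := by
  induction q, hq using Nat.le_induction with
  | base => norm_num
  | succ q hq ih =>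
    rw [show q + 1 - 3 = (q - 3) + 1 by omega, pow_succ]
    omega

/-- `q + 5·2^{j−3} ≤ j + 5·2^{q−3}` for `3 ≤ j ≤ q` (the flat family's monotonicity). -/
theorem add_five_two_pow_le (j q : ℕ) (hj : 3 ≤ j) (hjq : j ≤ q) : q + 5 * 2 ^ (j - 3) ≤ j + 5 * 2 ^ (q - 3) := by
  induction q, hjq using Nat.le_induction with
  | base => omega
  | succ q hq ih =>
    rw [show q + 1 - 3 = (q - 3) + 1 by omega, pow_succ]
    have : 1 ≤ 5 * 2 ^ (q - 3) := by
      have : 1 ≤ 2 ^ (q - 3) := Nat.one_le_two_pow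
      omega
    omega

end Explicit

/-- **THE FLAT FAMILY OF THE `e`-FREE CORE WITH `B = 5·2^{q−3} − 1`** (`q ≥ 7`): for `ρ(X) ≤ j ≤ q`,
`|X| + q ≤ (5·2^{q−3} − 1) + j` — from `ncard_le_five_two_pow_of_eRk_le_of_free` at `j ≥ 6` and the binary bound
`ncard_add_one_le_two_pow_of_eRk_le` at `j ≤ 5` (`|X| ≤ 31` and `q + 32 ≤ 5·2^{q−3}`). -/
theorem flat_family_five_two_pow_of_free (M : Matroid α) [M.Finite]
    (hfree : ∀ e ∈ M.E, ∃ A ⊆ M.E \ {e}, e ∉ M.closure A ∧ e ∉ M.closure ((M.E \ {e}) \ A))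
    (q : ℕ) (hq : 7 ≤ q) :
    ∀ j, j ≤ q → ∀ X ⊆ M.E, M.eRk X ≤ j → X.ncard + q ≤ (5 * 2 ^ (q - 3) - 1) + j := by
  intro j hj X hX hr
  have hq32 := Explicit.add_thirtytwo_le_five_two_pow q hq
  rcases Nat.lt_or_ge j 6 with h6 | h6
  · have hL := not_isLoop_of_free M hfree
    have h1 := ncard_add_one_le_two_pow_of_eRk_le M hL hfree j X hX hr
    have h2 : 2 ^ j ≤ 32 := by
      calc 2 ^ j ≤ 2 ^ 5 := Nat.pow_le_pow_right (by norm_num) (by omega)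
        _ = 32 := by norm_num
    omega
  · have h1 := ncard_le_five_two_pow_of_eRk_le_of_free M hfree j h6 X hX hr
    have h2 := Explicit.add_five_two_pow_le j q (by omega) hj
    have h3 : 1 ≤ 5 * 2 ^ (j - 3) := by
      have : 1 ≤ 2 ^ (j - 3) := Nat.one_le_two_pow
      omega
    omega

/-- **THE LARGE-CORANK CORE FROM THE CORE'S OWN FLAT BOUND** (`q ≥ 7`): corank `> q + 5·2^{q−3}`, `p ≥ N₁` (regime one
from `N₁` with `2^{5·2^{q−3}−1−q}`), `p ≥ P₂` (regime two from `P₂`), `p ≥ 5·2^{q−3} + 1` —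
p7's `core_all_corank_of_bound_key` at `B = 5·2^{q−3} − 1` with `flat_family_five_two_pow_of_free` and the regime-two key from
`choose_mul_le_choose_mul_of_threshold`. -/
theorem c025_core_explicit_large_of58 (q : ℕ) (hq : 7 ≤ q) (N₁ P₂ : ℕ)
    (hN₁ : ∀ n, N₁ ≤ n → 8 * (q + 1) * 2 ^ (5 * 2 ^ (q - 3) - 1 - q) * n ^ q ≤ 2 ^ n)
    (hP₂ : ∀ p, P₂ ≤ p →
      2 ^ (p + q) * 2 ^ (5 * 2 ^ (q - 3) - 1 - q) * (2 * (p - 1 - q) + 1) ≤ 4 ^ (p - 1 - q))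
    (M : Matroid α) [M.Finite] (p : ℕ) (hp : N₁ ≤ p) (hp2 : P₂ ≤ p) (hp3 : 5 * 2 ^ (q - 3) + 1 ≤ p)
    (hR : M.eRank = (p : ℕ∞)) (hbig : p + q + 5 * 2 ^ (q - 3) < M.E.ncard)
    (hfree : ∀ e ∈ M.E, ∃ A ⊆ M.E \ {e}, e ∉ M.closure A ∧ e ∉ M.closure ((M.E \ {e}) \ A)) :
    RLS M p q := by
  have hq32 := Explicit.add_thirtytwo_le_five_two_pow q hq
  refine core_all_corank_of_bound_key q (5 * 2 ^ (q - 3) - 1) (by omega) (by omega) N₁ hN₁ M p (by omega) (by omega) ?_ hR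
    ?_ hfree (flat_family_five_two_pow_of_free M hfree q hq)
  · intro n hn
    exact choose_mul_le_choose_mul_of_threshold n p q (2 ^ (5 * 2 ^ (q - 3) - 1 - q)) (by omega) hn (hP₂ p hp2)
  · omega

/-- **THE LEVEL FROM ONE EVALUATED ROW OVER THE 5/8 RANGE, WITH THE CHERNOFF TAIL AT ITS TOP CORANK**:
`c025_level_succ_of_key_row_tail` (RankLevelSetExplicitLin2LevelTail) with the core coranks `q + 2 ≤ d ≤ q + 1 + 5·2^{q−2}`
(the row `K p₀ d` there), the tail `8p₀ ≥ 9(q + 1 + 5·2^{q−2}) + 17(q+1) + 216` at that top corank, and the large-corank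
theorem `c025_core_explicit_large_of58` beyond it from the bases `N₁ ≤ p₀` (regime one; `2(q+1) ≤ N₁`, kernel `hbase₁`) and
`P₂ ≤ p₀` (regime two; `q + 3 ≤ P₂`, kernel `hbase₂`) with `5·2^{q−2} + 1 ≤ p₀`. -/
theorem c025_level_succ_of_key_row_tail58 (q : ℕ) (hq : 7 ≤ q) (p₀ N₁ P₂ : ℕ) (K : ℕ → ℕ → Prop)
    (hN₁ : N₁ ≤ p₀) (hm : 2 * (q + 1) ≤ N₁)
    (hbase₁ : 8 * (q + 1 + 1) * 2 ^ (5 * 2 ^ (q + 1 - 3) - 1 - (q + 1)) * N₁ ^ (q + 1) ≤ 2 ^ N₁)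
    (hP₂ : P₂ ≤ p₀) (hP₂q : q + 1 + 2 ≤ P₂)
    (hbase₂ : 2 ^ (P₂ + (q + 1)) * 2 ^ (5 * 2 ^ (q + 1 - 3) - 1 - (q + 1)) * (2 * (P₂ - 1 - (q + 1)) + 1) ≤
      4 ^ (P₂ - 1 - (q + 1)))
    (hp3 : 5 * 2 ^ (q + 1 - 3) + 1 ≤ p₀)
    (htail : 9 * (q + 1 + 5 * 2 ^ (q + 1 - 3)) + 17 * (q + 1) + 216 ≤ 8 * p₀)
    (hmono : ∀ p d, q + 1 ≤ d → K p d → K (p + 1) d)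
    (hcore : ∀ (M : Matroid α) [M.Finite] (p d : ℕ), q + 2 ≤ d → d ≤ q + 1 + 5 * 2 ^ (q + 1 - 3) →
      16 * ∑ j ∈ Finset.range (q + 1 + d + 1), (p + d).choose j ≤ 2 ^ (p + d) →
      K p d → M.eRank = (p : ℕ∞) → M.E.ncard = p + d →
      (∀ e ∈ M.E, ∃ A ⊆ M.E \ {e}, e ∉ M.closure A ∧ e ∉ M.closure ((M.E \ {e}) \ A)) → RLS M p (q + 1))
    (hrow : ∀ t < 5 * 2 ^ (q + 1 - 3), K p₀ (q + 2 + t))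
    (hprev : ∀ (M : Matroid α) [M.Finite] (p : ℕ), p₀ - 1 ≤ p → RLS M p q) :
    ∀ (M : Matroid α) [M.Finite] (p : ℕ), p₀ ≤ p → RLS M p (q + 1) := by
  intro M _ p hp
  have h2q : 2 ≤ 5 * 2 ^ (q + 1 - 3) := by
    have : 1 ≤ 2 ^ (q + 1 - 3) := Nat.one_le_two_pow
    omega
  refine rls_succ_large_at (α := α) q (q + 1) p (by omega) (fun M' _ => hprev M' (p - 1) (by omega)) ?_ ?_ M
  · intro M' _ hn
    rcases Nat.lt_or_ge M'.E.ncard (p + (q + 1)) with h | h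
    · exact RLS_of_ncard_lt M' h
    · exact RLS_of_ncard_eq M' (by omega)
  · intro M' _ hR hbig hfree
    rcases Nat.lt_or_ge M'.E.ncard (p + (q + 1) + 5 * 2 ^ (q + 1 - 3) + 1) with h | h
    · have hkey0 := hrow (M'.E.ncard - p - (q + 2)) (by omega)
      rw [show q + 2 + (M'.E.ncard - p - (q + 2)) = M'.E.ncard - p by omega] at hkey0
      have hkey := key_mono_of_succ K (M'.E.ncard - p) (fun p' => hmono p' (M'.E.ncard - p) (by omega)) p₀ p hp hkey0
      have hT := Explicit.sixteen_mul_sum_range_choose_le_chernoff (q + 1 + (M'.E.ncard - p)) (p + (M'.E.ncard - p))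
        (by omega)
      exact hcore M' p (M'.E.ncard - p) (by omega) (by omega) hT hkey hR (by omega) hfree
    · exact c025_core_explicit_large_of58 (q + 1) (by omega) N₁ P₂
        (Explicit.regime_one_of_base' (q + 1) (8 * (q + 1 + 1) * 2 ^ (5 * 2 ^ (q + 1 - 3) - 1 - (q + 1))) N₁ hm hbase₁)
        (Explicit.regime_two_of_base_exp (q + 1) (5 * 2 ^ (q + 1 - 3) - 1 - (q + 1)) P₂ hP₂q hbase₂) M' p (hN₁.trans hp)
        (hP₂.trans hp) (hp3.trans hp) hR (by omega) hfree

end ThmN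

end PercRepro
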